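import Literature.AlgebraicGeometry.Frobenioids.BiratLocalizationUniversal
import Literature.AlgebraicGeometry.Frobenioids.BirationalizationFunctor
import Literature.AlgebraicGeometry.Frobenioids.IsotropicFrobenioid
import Literature.AlgebraicGeometry.Frobenioids.IsotropicSubcategory
import Literature.AlgebraicGeometry.Frobenioids.IsometricPreSteps
import HarnessLib

/-!
# Frobenioids I, §4: the comparison functor `(C^istr)^birat → C^birat` and the transfer of
# Frobenius-normalizedness along it (input for Proposition 4.8 (iii))

Mochizuki, *The geometry of Frobenioids I: the general theory*, Kyushu J. Math. **62** (2008)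
293–400, §4, Prop. 4.4 (i)–(ii) pp. 82–84, Def. 4.5 (i) p. 86, Prop. 4.8 (iii) p. 88, together with
Prop. 1.9 (iv)–(v) pp. 31–33 [cite: MochizukiFrdI2008, Prop. 4.8 (iii) p.88].

PIECE `P48iii-c` of seat abc-iut-L6-t20's held node `FrdI:Prop4.8(iii)` ("if `C` is of rationally
standard type then `(C^istr)^birat` is of standard type"), written by seat abc-iut-L1-d5 at L6-t20's
specification (INBOX 2026-08-25T22:06:51Z); L6-t20's files are untouched and consume the results below
by name. The printed hypothesis "birationally Frobenius-normalized" (Def. 4.5 (i): every `A^birat` is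
Frobenius-normalized in `C^birat`) speaks about THE birationalization `C^birat` of `C`
(`PreFrobenioid.Birat F hF hsq`, seats abc-iut-L6-t8/L6-t6), whereas Def. 3.1 (i)(c) for
`(C^istr)^birat` speaks about the birationalization `Birat (istrFunctor F) (isFrobenioid_istr hF) hsq'`
of the Frobenioid `C^istr` (Prop. 1.9 (v), seat abc-iut-L1-t1). This file compares the two:

* `PreFrobenioid.Birat.ofIstr` — the functor `(C^istr)^birat ⥤ C^birat` induced (universal property
  of Prop. 4.4 (i), L6-t6's `Birat.lift`) by `C^istr ↪ C → C^birat`, which inverts the co-angular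
  pre-steps of `C^istr` (they are co-angular pre-steps of `C`, Prop. 1.9 (v));
* `Birat.toBirat_istr_comp_ofIstr` — it extends `C^istr ↪ C → C^birat`; `Birat.ofIstr_map_homMk` —
  on a class of fractions `[(α, φ′)]` it is the class of the same fraction read in `C`;
* `Birat.ofIstr_faithful`, `Birat.ofIstr_full` — it is fully faithful: a co-angular pre-step of `C`
  INTO an isotropic object has isotropic source (Prop. 1.9 (iv), L1-t1's
  `isIsotropic_iff_of_isCoAngular_isLinear`), so the fractions and the colimit relations of `C^birat`
  between isotropic objects already live in `C^istr`;
* `Birat.degFr_ofIstr_map`, `Birat.base_ofIstr_map` — it commutes with the structures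
  `(C^istr)^birat → F_{0_D}` and `C^birat → F_{0_D}` of Prop. 4.4 (ii) (Frobenius degrees and bases of
  a fraction are computed in `C`);
* TARGET `Birat.isFrobeniusNormalized_istr_of` — if `A^birat` (`A` isotropic) is Frobenius-normalized
  in `C^birat`, then it is Frobenius-normalized in `(C^istr)^birat` (apply `ofIstr`, use the
  hypothesis, pull the identity `φ ∘ α^d = α ∘ φ` back by faithfulness); and the type-level corollary
  `Birat.isOfFrobeniusNormalizedType_istr_of`: "`C` birationally Frobenius-normalized ⇒
  `(C^istr)^birat` of Frobenius-normalized type".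

The square-completion hypotheses `hsq`, `hsq'` (Prop. 1.11 (vii)) are those of the constructions.
No statement of the paper is strengthened; nothing here bears on [IUTchIII] Cor. 3.12.
-/

namespace Literature.AlgebraicGeometry.Frobenioids

open CategoryTheory Opposite

universe w v v' u u'

namespace PreFrobenioid

variable {D : Type u} [Category.{v} D] {Φ : Dᵒᵖ ⥤ CommMonCat.{w}}
  {C : Type u'} [Category.{v'} C] {F : C ⥤ ElemFrobenioid Φ}

namespace Birat

/-! ### The comparison functor `(C^istr)^birat → C^birat` -/

variable (hF : IsFrobenioid F) (hsq : HasBiratSquares F) (hsq' : HasBiratSquares (istrFunctor F))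

/-- The functor `C^istr ↪ C → C^birat` inverts the co-angular pre-steps of `C^istr` (they are
co-angular pre-steps of `C`, Prop. 1.9 (v); Prop. 4.4 (iv) "co-angular pre-step ↦ isomorphism").
[cite: MochizukiFrdI2008, Prop. 4.4 (iv) p.83] -/
theorem ι_toBirat_inverts :
    (coAngularPreSteps (istrFunctor F)).IsInvertedBy ((isotropicObjects F).ι ⋙ toBirat F hF hsq) :=
  fun _ _ α hα => toBirat_inverts hF hsq α.hom ((isCoAngularPreStep_istr_iff hF α).mp hα)

/-- **The comparison functor `(C^istr)^birat → C^birat`**: the functor induced on the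
birationalization of the Frobenioid `C^istr` (Prop. 1.9 (v)) by `C^istr ↪ C → C^birat`, via the
universal property of `C^istr → (C^istr)^birat` (Prop. 4.4 (i)). On objects `A ↦ A^birat`.
[cite: MochizukiFrdI2008, Prop. 4.4 (i) p.82] -/
noncomputable def ofIstr : Birat (istrFunctor F) (isFrobenioid_istr hF) hsq' ⥤ Birat F hF hsq :=
  Birat.lift (isFrobenioid_istr hF) hsq' ((isotropicObjects F).ι ⋙ toBirat F hF hsq)
    (ι_toBirat_inverts hF hsq)

/-- `ofIstr` extends `C^istr ↪ C → C^birat` along `C^istr → (C^istr)^birat` (on the nose).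
[cite: MochizukiFrdI2008, Prop. 4.4 (i) p.82] -/
theorem toBirat_istr_comp_ofIstr :
    toBirat (istrFunctor F) (isFrobenioid_istr hF) hsq' ⋙ ofIstr hF hsq hsq' =
      (isotropicObjects F).ι ⋙ toBirat F hF hsq :=
  toBirat_comp_lift _ _

variable {hF hsq hsq'}

/-- `ofIstr` on objects: `(A^istr)^birat ↦ A^birat`. [cite: MochizukiFrdI2008, Prop. 4.4 (i) p.82] -/
theorem ofIstr_obj (X : Birat (istrFunctor F) (isFrobenioid_istr hF) hsq') :
    (ofIstr hF hsq hsq').obj X = (toBirat F hF hsq).obj X.out.obj := rfl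

/-- A birational fraction `(α, φ′)` of `C^istr` read in `C` (its arrows are arrows of `C`, `α` is a
co-angular pre-step of `C` by Prop. 1.9 (v)). [cite: MochizukiFrdI2008, Prop. 4.4 (i) p.83] -/
theorem ofIstr_map_homMk {X Y : Birat (istrFunctor F) (isFrobenioid_istr hF) hsq'}
    (f : BiratFrac (istrFunctor F) X.out Y.out) :
    (ofIstr hF hsq hsq').map (homMk f) =
      (homMk ⟨f.src.obj, f.den.hom, f.num.hom, (isCoAngularPreStep_istr_iff hF f.den).mp f.den_mem⟩ :
        (toBirat F hF hsq).obj X.out.obj ⟶ (toBirat F hF hsq).obj Y.out.obj) := by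
  -- both sides are `(α^birat)⁻¹ ≫ φ′^birat` in `C^birat`
  refine Eq.trans ?_ (homMk_eq_inv_comp (hF := hF) (hsq := hsq)
    (⟨f.src.obj, f.den.hom, f.num.hom, (isCoAngularPreStep_istr_iff hF f.den).mp f.den_mem⟩ :
      BiratFrac F X.out.obj Y.out.obj)).symm
  rfl

/-! ### `ofIstr` is fully faithful -/

/-- The source of a co-angular pre-step of `C` into an isotropic object is isotropic (Prop. 1.9 (iv)).
[cite: MochizukiFrdI2008, Prop. 1.9 (iv) p.31] -/
theorem isIsotropic_src_of_isCoAngularPreStep (hF : IsFrobenioid F) {E A : C} (ε : E ⟶ A)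
    (hε : IsCoAngularPreStep F ε) (hA : IsIsotropic F A) : IsIsotropic F E :=
  (isIsotropic_iff_of_isCoAngular_isLinear hF ε hε.1 hε.2.1).mpr hA

/-- **`(C^istr)^birat → C^birat` is faithful**: a colimit relation in `C` between fractions with
isotropic apices is witnessed at an isotropic object (the refining co-angular pre-steps have isotropic
source, Prop. 1.9 (iv)), i.e. is a relation in `C^istr`. [cite: MochizukiFrdI2008, Prop. 4.4 (i) p.83] -/
theorem ofIstr_faithful : (ofIstr hF hsq hsq').Faithful := by
  refine ⟨fun {X Y} g₁ g₂ h => ?_⟩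
  obtain ⟨f₁, rfl⟩ := homMk_surjective g₁
  obtain ⟨f₂, rfl⟩ := homMk_surjective g₂
  rw [ofIstr_map_homMk, ofIstr_map_homMk] at h
  obtain ⟨E, ε, ε', hε, hε', hden, hnum⟩ := homMk_eq_homMk_iff.mp h
  have hE : IsIsotropic F E := isIsotropic_src_of_isCoAngularPreStep hF ε hε f₁.src.property
  apply homMk_sound
  refine ⟨Istr.mk E hE, ObjectProperty.homMk ε, ObjectProperty.homMk ε',
    (isCoAngularPreStep_istr_iff hF _).mpr hε, (isCoAngularPreStep_istr_iff hF _).mpr hε', ?_, ?_⟩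
  · exact ObjectProperty.hom_ext _ hden
  · exact ObjectProperty.hom_ext _ hnum

/-- **`(C^istr)^birat → C^birat` is full** (on its objects): a fraction `(α, φ′) : A ⇢ B` of `C`
between isotropic objects has isotropic apex (`α` is a co-angular pre-step into `A`, Prop. 1.9 (iv)),
hence is a fraction of `C^istr`. [cite: MochizukiFrdI2008, Prop. 4.4 (i) p.83] -/
theorem ofIstr_full : (ofIstr hF hsq hsq').Full := by
  refine ⟨fun {X Y} g => ?_⟩
  obtain ⟨f, rfl⟩ := homMk_surjective (X := (toBirat F hF hsq).obj X.out.obj)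
    (Y := (toBirat F hF hsq).obj Y.out.obj) g
  have hE : IsIsotropic F f.src := isIsotropic_src_of_isCoAngularPreStep hF f.den f.den_mem X.out.property
  refine ⟨homMk ⟨Istr.mk f.src hE, ObjectProperty.homMk f.den, ObjectProperty.homMk f.num,
    (isCoAngularPreStep_istr_iff hF _).mpr f.den_mem⟩, ?_⟩
  rw [ofIstr_map_homMk]
  rfl

/-! ### Compatibility with `(C^istr)^birat → F_{0_D}` and `C^birat → F_{0_D}` -/

/-- `ofIstr` preserves Frobenius degrees (both are `deg_Fr(φ′)` of a representing fraction).
[cite: MochizukiFrdI2008, Prop. 4.4 (iv) p.83] -/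
theorem degFr_ofIstr_map {X Y : Birat (istrFunctor F) (isFrobenioid_istr hF) hsq'} (g : X ⟶ Y) :
    degFr (toElemZero hF hsq) ((ofIstr hF hsq hsq').map g) =
      degFr (toElemZero (isFrobenioid_istr hF) hsq') g := by
  obtain ⟨f, rfl⟩ := homMk_surjective g
  rw [ofIstr_map_homMk]
  rfl

/-- `ofIstr` preserves bases (both are `Base(α)⁻¹ ≫ Base(φ′)` of a representing fraction).
[cite: MochizukiFrdI2008, Prop. 4.4 (i) p.84] -/
theorem base_ofIstr_map {X Y : Birat (istrFunctor F) (isFrobenioid_istr hF) hsq'} (g : X ⟶ Y) :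
    Base (toElemZero hF hsq) ((ofIstr hF hsq hsq').map g) =
      Base (toElemZero (isFrobenioid_istr hF) hsq') g := by
  obtain ⟨f, rfl⟩ := homMk_surjective g
  rw [ofIstr_map_homMk]
  rfl

/-- `ofIstr` preserves base-identity endomorphisms. [cite: MochizukiFrdI2008, Prop. 4.4 (i) p.84] -/
theorem isBaseIdentity_ofIstr_map {X : Birat (istrFunctor F) (isFrobenioid_istr hF) hsq'} (g : X ⟶ X)
    (h : IsBaseIdentity (toElemZero (isFrobenioid_istr hF) hsq') g) :
    IsBaseIdentity (toElemZero hF hsq) ((ofIstr hF hsq hsq').map g) := by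
  unfold IsBaseIdentity
  rw [base_ofIstr_map]
  exact h

/-- `ofIstr` carries `O^▷` into `O^▷`. [cite: MochizukiFrdI2008, Prop. 4.4 (i) p.84] -/
theorem mem_endSubmonoid_ofIstr_map {X : Birat (istrFunctor F) (isFrobenioid_istr hF) hsq'}
    (g : End X) (h : g ∈ endSubmonoid (toElemZero (isFrobenioid_istr hF) hsq') X) :
    (ofIstr hF hsq hsq').map g ∈ endSubmonoid (toElemZero hF hsq) ((ofIstr hF hsq hsq').obj X) := by
  refine ⟨isBaseIdentity_ofIstr_map g h.1, ?_⟩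
  unfold IsLinear
  rw [degFr_ofIstr_map]
  exact h.2

/-! ### Transfer of Frobenius-normalizedness -/

/-- **Frobenius-normalizedness transfers from `C^birat` to `(C^istr)^birat`**: for an isotropic `A`,
if `A^birat` is Frobenius-normalized in `C^birat` then it is Frobenius-normalized in `(C^istr)^birat`
— for a base-identity endomorphism `φ` and `α ∈ O^▷` of `A` in `(C^istr)^birat`, their images under
`ofIstr` are a base-identity endomorphism and an element of `O^▷` of `A^birat` (degrees and bases are
preserved), the relation `α^{deg φ} ∘ φ = φ ∘ α` holds there, and `ofIstr` is faithful.
[cite: MochizukiFrdI2008, Prop. 4.8 (iii) p.88] -/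
theorem isFrobeniusNormalized_istr_of (A : Istr F)
    (h : IsFrobeniusNormalized (toElemZero hF hsq) ((toBirat F hF hsq).obj A.obj)) :
    IsFrobeniusNormalized (toElemZero (isFrobenioid_istr hF) hsq')
      ((toBirat (istrFunctor F) (isFrobenioid_istr hF) hsq').obj A) := by
  intro φ hφ α hα
  haveI := ofIstr_faithful (hF := hF) (hsq := hsq) (hsq' := hsq')
  -- notation-free abbreviations (kept syntactically as `(toBirat …).obj A`, see the typing of `Birat`)
  let Xi : Birat (istrFunctor F) (isFrobenioid_istr hF) hsq' :=
    (toBirat (istrFunctor F) (isFrobenioid_istr hF) hsq').obj A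
  let P : Birat (istrFunctor F) (isFrobenioid_istr hF) hsq' ⥤ Birat F hF hsq := ofIstr hF hsq hsq'
  let M : End Xi →* End (P.obj Xi) := P.mapEnd Xi
  -- the images of `φ`, `α` in `C^birat` satisfy the Frobenius-normalization identity
  have key : P.map φ ≫ (show P.obj Xi ⟶ P.obj Xi from
      (M α) ^ (degFr (toElemZero hF hsq) (P.map φ) : ℕ)) = (show P.obj Xi ⟶ P.obj Xi from M α) ≫ P.map φ :=
    h (P.map φ) (isBaseIdentity_ofIstr_map (X := Xi) φ hφ) (M α)
      (mem_endSubmonoid_ofIstr_map (X := Xi) α hα)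
  -- degrees are preserved by `ofIstr`
  have hn : degFr (toElemZero hF hsq) (P.map φ) = degFr (toElemZero (isFrobenioid_istr hF) hsq') φ :=
    degFr_ofIstr_map (X := Xi) (Y := Xi) φ
  have hpow : P.map (show Xi ⟶ Xi from α ^ (degFr (toElemZero (isFrobenioid_istr hF) hsq') φ : ℕ)) =
      (show P.obj Xi ⟶ P.obj Xi from
        (M α) ^ (degFr (toElemZero (isFrobenioid_istr hF) hsq') φ : ℕ)) :=
    map_pow M α _
  have e2 := congrArg (fun k : ℕ+ => P.map φ ≫ (show P.obj Xi ⟶ P.obj Xi from (M α) ^ (k : ℕ))) hn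
  -- pull back along the faithful functor `ofIstr`
  apply P.map_injective
  exact (P.map_comp _ _).trans ((congrArg (P.map φ ≫ ·) hpow).trans
    (e2.symm.trans (key.trans (P.map_comp _ _).symm)))

/-- **Type-level corollary** (the form consumed in Prop. 4.8 (iii)): if every `A^birat`, `A ∈ Ob(C)`,
is Frobenius-normalized in `C^birat` ("`C` is of birationally Frobenius-normalized type", Def. 4.5
(i)), then `(C^istr)^birat` is of Frobenius-normalized type. [cite: MochizukiFrdI2008, Prop. 4.8 (iii) p.88] -/
theorem isOfFrobeniusNormalizedType_istr_of
    (h : ∀ A : C, IsFrobeniusNormalized (toElemZero hF hsq) ((toBirat F hF hsq).obj A)) :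
    IsOfType (IsFrobeniusNormalized (toElemZero (isFrobenioid_istr hF) hsq')) :=
  fun X => isFrobeniusNormalized_istr_of (hsq' := hsq') X.out (h X.out.obj)

end Birat

end PreFrobenioid

end Literature.AlgebraicGeometry.Frobenioids
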